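import Summits.ResolutionOfSingularities.ResolutionOfSingularities.Theorems.PurelyInseparableDim4SwapTransportWindowIterPrime
import Summits.ResolutionOfSingularities.ResolutionOfSingularities.Theorems.PurelyInseparableDim4ResConeCInfCornerWindowPrime
import HarnessLib
import HarnessLib.Audit.Tags

/-!
# Purely inseparable four-folds — THE VIRTUAL WINDOW IS PLAYED, FOR EVERY PRIME `p`: res-dim4-p-3 g5's finite C∞ game
# `ResCone.no_cInf_corner_window_prime` on the `T + 1` pure virtual slot steps of W5a (cell `res-dim4-pi`, K2(p) lane, rung-1
# POWER-CONE LINE «light pair of TAIL(p, p−1, 3) ∀ p», window half W5b; the `p = 5` instance is §3 of res-dim4-typ-1 g3's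
# `…SwapTransportWindowIter` p701850 over p-3 g4's `cInf_window_false`)

[OURS · counted 0 · cell `res-dim4-pi` · K2(p) lane (holder res-dim4-p-12 g5, rulings g5-2 (6) / g5-6) · seat res-dim4-typ-1 g5; the
game half is res-dim4-p-3 g5's `…CInfCornerWindowPrime` over res-dim4-p-9's C∞ game with the window constant of
`…CInfGameWindowPrime` (`T ≥ 4(d − 1) + 2`).]  Nothing here proves K2(p) for any `p`, any TAIL(p, p−1, 3), any TAIL(7, d, e),
`NoIsolatedTrap p p` or resolution of singularities in dimension ≥ 4 / characteristic `p` — NOT proved.  AI kernel work, weaker than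
expert review.  This file closes nothing by itself: it reduces the light pair of every TAIL(p, p−1, 3) to the ENTRY (a framed virtual
partner at ONE real time, res-dim4-p-3's ENTRY-1…5) plus a virtual letter change; at `d ≥ 6` the entry's flag is OPEN (Q-FLAG).

**`virtual_window_false_of_entry_prime`** — given an ENTRY (a framed virtual state with dead ROW `(eu, ef)`, `eu + ef = d − 2`, and
FLAG, related to the real state `c k` along `π₀`; `Nc` a common isolation certificate level of `c k, …, c (k+T+1)`), the virtual data
`(πs, Bs, ℓs)` generated by the recursion rule, `T ≥ 4(d − 1) + 2`, budgets `Nc + 2p + 2 + p(T+1) ≤ M`, `d + 4 + d(T+1) ≤ N`, and a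
virtual letter change at the start (`ℓs 0 = λ`, `ℓs 1 = μ`): `False` — W5a `virtual_iterate_prime` for `T + 1` steps, coefficient-
straightness at `Bs 0` from the frame's `resForm` by res-dim4-p-3's `straight_readings_of_resForm_prime`, then
`ResCone.no_cInf_corner_window_prime` on `Bs`.
[cite: Hauser2010, §§F–G] [cite: CossartJannsenSaito2020, Thm. 3.14]
bears_on: LADDER-RESOLUTION:D157-DOOR2 (res-dim4-pi · K2(p) · power cones · virtual window played ∀ p).  Supports
stmt-ResolutionOfSingularities-16155 (helper).
-/

set_option linter.dupNamespace false -- mandated namespace of this single-conjunct summit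

noncomputable section

namespace Summit.ResolutionOfSingularities.ResolutionOfSingularities.Theorems.PIDim4

namespace SwapTransport

open MvPolynomial Finset
open Literature.AlgebraicGeometry.Resolution
open Literature.AlgebraicGeometry.Resolution.CentreBlowup
open Literature.AlgebraicGeometry.Resolution.Hauser2010
open Literature.AlgebraicGeometry.Resolution.HauserPerlega2019

variable {K : Type} [Field K] [DecidableEq K]

/-! ## The window from an entry, every prime -/

/-- **THE VIRTUAL WINDOW IS PLAYED, every prime** (module docstring, §3): from an entry at real time `k`, `T + 1` shadowed steps
(`virtual_step_any_prime`), `T ≥ 4(d − 1) + 2`, and res-dim4-p-3 g5's `ResCone.no_cInf_corner_window_prime` on the shadow.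
[OURS] [cite: Hauser2010, §§F–G] [cite: CossartJannsenSaito2020, Thm. 3.14] -/
theorem virtual_window_false_of_entry_prime (p : ℕ) [Fact p.Prime] [CharP K p] {d : ℕ} (hdp : d + 1 = p) (hd2 : 2 ≤ d)
    {eu ef : ℕ} (hef : eu + ef = d - 2) {la mu u f : Fin 4} (hlm : la ≠ mu) (hlu : la ≠ u) (hlf : la ≠ f) (hmu : mu ≠ u) (hmf : mu ≠ f) (huf : u ≠ f)
    {c : ℕ → State K} {j : ℕ → Fin 4} {b : ℕ → Fin 4 → K} (hw : FreeTail.IsWitnessedChain p c j b) {k Nc T : ℕ}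
    (hT : 4 * (d - 1) + 2 ≤ T) (hisoR : ∀ t, t ≤ T + 1 → IsIsolated p (c (k + t)).F)
    (hcert : ∀ t, t ≤ T + 1 → originIdeal K ^ Nc ≤ singLocusIdeal p (c (k + t)).F ⊔ originIdeal K ^ (Nc + 1))
    (hoR : ∀ t, t ≤ T + 1 → ordZero (c (k + t)).F = ((d + 2 : ℕ) : ℕ∞))
    (he3R : ∀ t, t ≤ T + 1 → Module.finrank K (ResCone.resVertex (c (k + t))) = 3)
    (hwtR : ∀ t, t ≤ T + 1 → (∀ i, (c (k + t)).r i ≤ 1) ∧ (c (k + t)).r.degree = 2)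
    (hdivR : ∀ t, t ≤ T + 1 → ∀ e ∈ (c (k + t)).F.support, (c (k + t)).r ≤ e)
    {πs : ℕ → Equiv.Perm (Fin 4)} {Bs : ℕ → State K} {ℓs : ℕ → Fin 4}
    (hBs : ∀ t, Bs (t + 1) = CentreBlowup.step p Finset.univ (ℓs t) 0 (Bs t))
    (hℓs : ∀ t, ℓs t = if j (k + t) = πs t la then la else if j (k + t) = πs t mu then mu
      else if b (k + t) (πs t la) ≠ 0 then la else mu)
    (hπs : ∀ t, πs (t + 1) = if j (k + t) = πs t la ∨ j (k + t) = πs t mu then πs t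
      else (Equiv.swap (ℓs t) ((πs t).symm (j (k + t)))).trans (πs t))
    {M N : ℕ} (hM : Nc + 2 * p + 2 + p * (T + 1) ≤ M) (hN : d + 4 + d * (T + 1) ≤ N)
    (hrel0 : ∃ (θ e : Fin 4 → MvPolynomial (Fin 4) K) (U E : MvPolynomial (Fin 4) K),
      θ (πs 0 la) = X la * e la ∧ θ (πs 0 mu) = X mu * e mu ∧ constantCoeff (e la) ≠ 0 ∧ constantCoeff (e mu) ≠ 0 ∧
      constantCoeff (θ (πs 0 u)) = 0 ∧ constantCoeff (θ (πs 0 f)) = 0 ∧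
      coeff (Finsupp.single u 1) (θ (πs 0 u)) * coeff (Finsupp.single f 1) (θ (πs 0 f)) -
        coeff (Finsupp.single f 1) (θ (πs 0 u)) * coeff (Finsupp.single u 1) (θ (πs 0 f)) ≠ 0 ∧
      constantCoeff U ≠ 0 ∧ E ∈ originIdeal K ^ M ∧ (Bs 0).F = deletePthPowers p (U ^ p * aeval θ (c k).F) + E)
    (hrA0 : (c k).r = Finsupp.single (πs 0 la) 1 + Finsupp.single (πs 0 mu) 1)
    (hfr0 : ordZero (Bs 0).F = ((d + 2 : ℕ) : ℕ∞) ∧ (Bs 0).r = Finsupp.single la 1 + Finsupp.single mu 1 ∧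
      (∀ e ∈ (Bs 0).F.support, (Bs 0).r ≤ e) ∧ (∃ a : K, a ≠ 0 ∧ ResCone.resForm (Bs 0) = C a * X f ^ d) ∧
      (∀ e ∈ (Bs 0).F.support, e f ≤ d - 1 → 2 ≤ e la ∧ 2 ≤ e mu) ∧
      (∀ e ∈ (Bs 0).F.support, e.degree < N → ¬ (e u = eu ∧ e f = ef)) ∧
      coeff ((Bs 0).r + (Finsupp.single la 1 + Finsupp.single mu 1 + Finsupp.single u (eu + 1) + Finsupp.single f ef)) (Bs 0).F ≠ 0 ∧
      IsIsolated p (Bs 0).F ∧ Module.finrank K (ResCone.resVertex (Bs 0)) = 3)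
    (hx0 : ℓs 0 = la) (hx1 : ℓs 1 = mu) : False := by
  have hP := virtual_iterate_prime p hdp hd2 hef hlm hlu hlf hmu hmf huf hw hisoR hcert hoR he3R hwtR hdivR hBs hℓs hπs
    (T := T + 1) hM hN hrel0 hrA0 hfr0
  have hslot : ∀ t, t ≤ T → ℓs t = la ∨ ℓs t = mu := fun t _ => by
    rw [hℓs t]
    split_ifs
    exacts [Or.inl rfl, Or.inr rfl, Or.inl rfl, Or.inr rfl]
  -- coefficient-straightness of the first virtual state from its residual form
  obtain ⟨a, ha, hform0⟩ := hfr0.2.2.2.1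
  have hrdeg0 : (Bs 0).r.degree = 2 := by rw [hfr0.2.1, map_add, Finsupp.degree_single, Finsupp.degree_single]
  obtain ⟨ha0, hstraight0⟩ := ResCone.straight_readings_of_resForm_prime hfr0.1 hrdeg0 hform0
  exact ResCone.no_cInf_corner_window_prime hlm hlu hlf hmu hmf huf p hdp hd2 hT (c := Bs) (j := ℓs)
    (fun t ht => (hP t ht).2.2.2.2.2.2.2.2.2.1) (fun t ht => (hP t ht).2.2.1) (fun t ht => (hP t ht).2.2.2.2.2.2.2.2.2.2)
    (fun t ht => (hP t ht).2.2.2.2.1) (fun t _ => hBs t) hslot (fun t ht => (hP t ht).2.2.2.1) (by rw [ha0]; exact ha)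
    hstraight0 hfr0.2.2.2.2.1 hx0 hx1

end SwapTransport

end Summit.ResolutionOfSingularities.ResolutionOfSingularities.Theorems.PIDim4

end
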